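import Summits.QuantumFields.YangMills.Theorems.UnitScaleTiltFluctuationComparisonRegPrAnsatzSRows

/-!
# Route `UnitScaleTilt` — crux K1bR-pr `FluctuationComparisonRegPr` (stmt-QuantumFields-19201), stub `stub_oneStepSmallLift`
# (W7 line), kernel data «ANSATZ S», part 3: orientations `(0,2)`, `(1,2)`, THE ROW BOUND `λ_S(L) = L/(5L−12)` MODULO COARSE
# 2-BOUNDARIES OF MASS `(L−2)/(5L−12)` for every `L ≥ 5`, and THE PER-`L` CLAUSE OF THE REGISTERED STUB FOR ODD `5 ≤ L ≤ 19`
# (support file `--supports stmt-QuantumFields-19201`)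

Cell `ym3-torus` (rung R3), seat `ym3-torus-p2` gen 10 (CARD-19201-oneStepSmallLift-v3 §A).

* §1 `row02`, `row12` (as `row01` in `…AnsatzSRows`, with `ε = −1`, `+1`);
* §2 **`rowBound_P3`**: `RowBound n 1 (kzS P) (L·α) ((L−2)·α)` for the literal `d = 3` parameters, hence **`kernel_hypotheses`**: the four
  hypotheses of `ApproxLift.approxSmallLift_of_kernel` at every run of every `T3Family` with `L ≥ 5` (table `kzS (F.P 0)`, `K₁ = 36(L−2)α`);
* §3 **`gain_lt_one`**: `(L·α)·√L < 1` for `5 ≤ L ≤ 19` (`⇔ L³ < (5L−12)²`; false from `L = 20` on), and **`perL_clause`**: for odd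
  `5 ≤ L ≤ 19`, `∃ κ₀ C δ₀, 0 ≤ κ₀ ∧ κ₀√L < 1 ∧ 0 ≤ C ∧ 0 < δ₀ ∧ ∀ F, F.L = L → ApproxSmallLift F κ₀ C δ₀` — the `L`-th hypothesis of
  `ApproxLift.oneStepSmallLift_stub_of_approx` (p2 g8), by the fleet's face assembly `exists_approxSmallLift_of_kernel` (F7, p478011).
  With `CertL3Face`/`CertL5` (L = 3, 5) this leaves exactly the odd `L ≥ 21` to the general (interior-supported, dual-Whitney) pipeline.

Elementary; nothing of Bałaban's is asserted.
-/

noncomputable section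

open scoped BigOperators Matrix.Norms.L2Operator
open NormedSpace

namespace Summit.QuantumFields.YangMills.Theorems.ApproxLift.AnsatzS

open Literature.MathematicalPhysics.QuantumFieldTheory.Balaban1983to89
open Literature.MathematicalPhysics.QuantumFieldTheory.Balaban1983to89.T3ContinuumYM3Torus
open T4Continuum BlockAveraging

/-! ## §1 The orientation classes `(0,2)` and `(1,2)` -/

section Rows

variable {n : Type*} [Fintype n] [DecidableEq n]
variable {L m K : ℕ} {hL : Odd L ∧ 1 < L}

/-- Orientation `(0,2)` (normal direction `1`, `ε = −1`). -/
theorem row02 (hL5 : 5 ≤ L) (pp : Fin 3 → Fin L) (w : Orient 3 → (Fin 3 → ℤ) → Matrix n n ℂ) {Bw Bd : ℝ}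
    (hw : ∀ o s, ‖w o s‖ ≤ Bw)
    (hd : ∀ s : Fin 3 → ℤ, (∀ i, (s i).natAbs ≤ 1 + 1) → ‖d2 w 0 1 2 o01.2 o12.2 s‖ ≤ Bd) (hBw : 0 ≤ Bw) (hBd : 0 ≤ Bd)
    (h : (0 : Fin 3) < 2) :
    ‖(if exbC (P := P3 L m K hL) pp 0 = true ∧ exbC (P := P3 L m K hL) pp 2 = true then w ⟨(0, 2), h⟩ 0 else 0) +
        rowFormC (P := P3 L m K hL) 1 (kzS (P3 L m K hL)) pp 0 2 w‖ ≤
      ((L : ℝ) * alpha L) * Bw + (((L : ℝ) - 2) * alpha L) * Bd := by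
  have hL3 : 3 ≤ L := by omega
  have h5 : (5 : ℝ) ≤ L := by exact_mod_cast hL5
  have hα := (alpha_pos hL3).le
  have hl0 : 0 ≤ (L : ℝ) * alpha L * Bw := mul_nonneg (mul_nonneg (by positivity) hα) hBw
  have hb0 : 0 ≤ ((L : ℝ) - 2) * alpha L * Bd := mul_nonneg (mul_nonneg (by linarith) hα) hBd
  have hq1 : ((pp 1 : Fin L) : ℕ) < L := (pp 1).isLt
  rw [rowFormC, eval_row₀, eval_row, eval_row, eval_row₀]
  simp only [sum_orient3, f01, f02, f20, f21, if_true, if_false, sub_zero, zero_sub, add_zero, zero_add]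
  rw [succOff_ne pp (show (1 : Fin 3) ≠ 0 by decide), succOff_ne pp (show (2 : Fin 3) ≠ 0 by decide),
    succOff_ne pp (show (0 : Fin 3) ≠ 2 by decide), succOff_ne pp (show (1 : Fin 3) ≠ 2 by decide),
    succOff_val_self, succOff_val_self]
  by_cases ex0 : ((pp 0 : Fin L) : ℕ) = L - 1
  · have hm0 : (L - 1 + 1) % L = 0 := by rw [Nat.sub_add_cancel (by omega), Nat.mod_self]
    by_cases ex2 : ((pp 2 : Fin L) : ℕ) = L - 1
    · -- corner line
      simp only [exbC, ex0, ex2, hm0, decide_true, and_self, if_true, bvec_true, phi0_zero, phim1_zero, phi0_last hL3,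
        phim1_last hL3, Complex.ofReal_zero, zero_smul, zero_add, add_zero, sub_self, Complex.ofReal_neg, neg_smul]
      refine (congrArg norm (?_ : _ =
        (((1 - 4 * (((L : ℝ) - 2) * alpha L) + phi0 L (pp 1) - phim1 L (pp 1) : ℝ)) : ℂ) • w o02 0 +
        (((-phi0 L (pp 1) : ℝ)) : ℂ) • w o02 (unitZ 1) + ((phim1 L (pp 1) : ℝ) : ℂ) • w o02 (-unitZ 1) +
        (((-phi0 L (pp 1) : ℝ)) : ℂ) • d2 w 0 1 2 o01.2 o12.2 0 +
        (((-phim1 L (pp 1) : ℝ)) : ℂ) • d2 w 0 1 2 o01.2 o12.2 (-unitZ 1))).trans_le ?_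
      · simp only [d2, zero_add, sub_eq_neg_add, neg_add_cancel]
        push_cast
        module
      · refine (norm_five_le (hw _ _) (hw _ _) (hw _ _) (hd _ natAbs_zero_apply) (hd _ (natAbs_neg_unitZ_apply 1))).trans ?_
        have h1 := corner_coeff_le hL5 hq1
        have h2 := corner_chain_le hL5 hq1
        simp only [abs_neg]
        exact add_le_add (mul_le_mul_of_nonneg_right h1 hBw) (mul_le_mul_of_nonneg_right h2 hBd)
    · -- exit in direction 0 only
      have hq : ((pp 2 : Fin L) : ℕ) + 2 ≤ L := by have := (pp 2).isLt; omega
      have hm1 : (((pp 2 : Fin L) : ℕ) + 1) % L = ((pp 2 : Fin L) : ℕ) + 1 := Nat.mod_eq_of_lt (by omega)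
      simp only [exbC, ex0, ex2, hm1, decide_true, decide_false, Bool.false_eq_true, and_false, if_true, if_false, bvec_false,
        zero_add, sub_zero, zero_sub]
      refine (congrArg norm (?_ : _ =
        ((phi0 L (pp 2) - phi0 L ((pp 2 : ℕ) + 1) : ℝ) : ℂ) • w o02 0 +
        ((phim1 L (pp 2) - phim1 L ((pp 2 : ℕ) + 1) : ℝ) : ℂ) • w o02 (-unitZ 2))).trans_le ?_
      · push_cast
        module
      · exact (norm_two_le (hw _ _) (hw _ _)).trans
          ((mul_le_mul_of_nonneg_right (single_coeff_le hL5 hq) hBw).trans (le_add_of_nonneg_right hb0))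
  · by_cases ex2 : ((pp 2 : Fin L) : ℕ) = L - 1
    · -- exit in direction 2 only
      have hq : ((pp 0 : Fin L) : ℕ) + 2 ≤ L := by have := (pp 0).isLt; omega
      have hm1 : (((pp 0 : Fin L) : ℕ) + 1) % L = ((pp 0 : Fin L) : ℕ) + 1 := Nat.mod_eq_of_lt (by omega)
      simp only [exbC, ex0, ex2, hm1, decide_true, decide_false, Bool.false_eq_true, false_and, if_true, if_false, bvec_false,
        zero_add, sub_zero, zero_sub]
      refine (congrArg norm (?_ : _ =
        ((phi0 L (pp 0) - phi0 L ((pp 0 : ℕ) + 1) : ℝ) : ℂ) • w o02 0 +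
        ((phim1 L (pp 0) - phim1 L ((pp 0 : ℕ) + 1) : ℝ) : ℂ) • w o02 (-unitZ 0))).trans_le ?_
      · push_cast
        module
      · exact (norm_two_le (hw _ _) (hw _ _)).trans
          ((mul_le_mul_of_nonneg_right (single_coeff_le hL5 hq) hBw).trans (le_add_of_nonneg_right hb0))
    · -- interior plaquette
      simp only [exbC, ex0, ex2, decide_false, Bool.false_eq_true, false_and, if_false, zero_add, sub_zero, norm_zero]
      exact add_nonneg hl0 hb0

/-- Orientation `(1,2)` (normal direction `0`, `ε = +1`). -/
theorem row12 (hL5 : 5 ≤ L) (pp : Fin 3 → Fin L) (w : Orient 3 → (Fin 3 → ℤ) → Matrix n n ℂ) {Bw Bd : ℝ}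
    (hw : ∀ o s, ‖w o s‖ ≤ Bw)
    (hd : ∀ s : Fin 3 → ℤ, (∀ i, (s i).natAbs ≤ 1 + 1) → ‖d2 w 0 1 2 o01.2 o12.2 s‖ ≤ Bd) (hBw : 0 ≤ Bw) (hBd : 0 ≤ Bd)
    (h : (1 : Fin 3) < 2) :
    ‖(if exbC (P := P3 L m K hL) pp 1 = true ∧ exbC (P := P3 L m K hL) pp 2 = true then w ⟨(1, 2), h⟩ 0 else 0) +
        rowFormC (P := P3 L m K hL) 1 (kzS (P3 L m K hL)) pp 1 2 w‖ ≤
      ((L : ℝ) * alpha L) * Bw + (((L : ℝ) - 2) * alpha L) * Bd := by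
  have hL3 : 3 ≤ L := by omega
  have h5 : (5 : ℝ) ≤ L := by exact_mod_cast hL5
  have hα := (alpha_pos hL3).le
  have hl0 : 0 ≤ (L : ℝ) * alpha L * Bw := mul_nonneg (mul_nonneg (by positivity) hα) hBw
  have hb0 : 0 ≤ ((L : ℝ) - 2) * alpha L * Bd := mul_nonneg (mul_nonneg (by linarith) hα) hBd
  have hq0 : ((pp 0 : Fin L) : ℕ) < L := (pp 0).isLt
  rw [rowFormC, eval_row₀, eval_row, eval_row, eval_row₀]
  simp only [sum_orient3, f10, f12, f20, f21, if_true, if_false, sub_zero, zero_sub, add_zero, zero_add]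
  rw [succOff_ne pp (show (0 : Fin 3) ≠ 1 by decide), succOff_ne pp (show (2 : Fin 3) ≠ 1 by decide),
    succOff_ne pp (show (0 : Fin 3) ≠ 2 by decide), succOff_ne pp (show (1 : Fin 3) ≠ 2 by decide),
    succOff_val_self, succOff_val_self]
  by_cases ex1 : ((pp 1 : Fin L) : ℕ) = L - 1
  · have hm0 : (L - 1 + 1) % L = 0 := by rw [Nat.sub_add_cancel (by omega), Nat.mod_self]
    by_cases ex2 : ((pp 2 : Fin L) : ℕ) = L - 1
    · -- corner line
      simp only [exbC, ex1, ex2, hm0, decide_true, and_self, if_true, bvec_true, phi0_zero, phim1_zero, phi0_last hL3,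
        phim1_last hL3, Complex.ofReal_zero, zero_smul, zero_add, add_zero, sub_self, Complex.ofReal_neg, neg_smul]
      refine (congrArg norm (?_ : _ =
        (((1 - 4 * (((L : ℝ) - 2) * alpha L) + phi0 L (pp 0) - phim1 L (pp 0) : ℝ)) : ℂ) • w o12 0 +
        (((-phi0 L (pp 0) : ℝ)) : ℂ) • w o12 (unitZ 0) + ((phim1 L (pp 0) : ℝ) : ℂ) • w o12 (-unitZ 0) +
        ((phi0 L (pp 0) : ℝ) : ℂ) • d2 w 0 1 2 o01.2 o12.2 0 +
        ((phim1 L (pp 0) : ℝ) : ℂ) • d2 w 0 1 2 o01.2 o12.2 (-unitZ 0))).trans_le ?_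
      · simp only [d2, zero_add, sub_eq_neg_add, neg_add_cancel]
        push_cast
        module
      · refine (norm_five_le (hw _ _) (hw _ _) (hw _ _) (hd _ natAbs_zero_apply) (hd _ (natAbs_neg_unitZ_apply 0))).trans ?_
        have h1 := corner_coeff_le hL5 hq0
        have h2 := corner_chain_le hL5 hq0
        rw [abs_neg]
        exact add_le_add (mul_le_mul_of_nonneg_right h1 hBw) (mul_le_mul_of_nonneg_right h2 hBd)
    · -- exit in direction 1 only
      have hq : ((pp 2 : Fin L) : ℕ) + 2 ≤ L := by have := (pp 2).isLt; omega
      have hm1 : (((pp 2 : Fin L) : ℕ) + 1) % L = ((pp 2 : Fin L) : ℕ) + 1 := Nat.mod_eq_of_lt (by omega)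
      simp only [exbC, ex1, ex2, hm1, decide_true, decide_false, Bool.false_eq_true, and_false, if_true, if_false, bvec_false,
        zero_add, sub_zero, zero_sub]
      refine (congrArg norm (?_ : _ =
        ((phi0 L (pp 2) - phi0 L ((pp 2 : ℕ) + 1) : ℝ) : ℂ) • w o12 0 +
        ((phim1 L (pp 2) - phim1 L ((pp 2 : ℕ) + 1) : ℝ) : ℂ) • w o12 (-unitZ 2))).trans_le ?_
      · push_cast
        module
      · exact (norm_two_le (hw _ _) (hw _ _)).trans
          ((mul_le_mul_of_nonneg_right (single_coeff_le hL5 hq) hBw).trans (le_add_of_nonneg_right hb0))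
  · by_cases ex2 : ((pp 2 : Fin L) : ℕ) = L - 1
    · -- exit in direction 2 only
      have hq : ((pp 1 : Fin L) : ℕ) + 2 ≤ L := by have := (pp 1).isLt; omega
      have hm1 : (((pp 1 : Fin L) : ℕ) + 1) % L = ((pp 1 : Fin L) : ℕ) + 1 := Nat.mod_eq_of_lt (by omega)
      simp only [exbC, ex1, ex2, hm1, decide_true, decide_false, Bool.false_eq_true, false_and, if_true, if_false, bvec_false,
        zero_add, sub_zero, zero_sub]
      refine (congrArg norm (?_ : _ =
        ((phi0 L (pp 1) - phi0 L ((pp 1 : ℕ) + 1) : ℝ) : ℂ) • w o12 0 +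
        ((phim1 L (pp 1) - phim1 L ((pp 1 : ℕ) + 1) : ℝ) : ℂ) • w o12 (-unitZ 1))).trans_le ?_
      · push_cast
        module
      · exact (norm_two_le (hw _ _) (hw _ _)).trans
          ((mul_le_mul_of_nonneg_right (single_coeff_le hL5 hq) hBw).trans (le_add_of_nonneg_right hb0))
    · -- interior plaquette
      simp only [exbC, ex1, ex2, decide_false, Bool.false_eq_true, false_and, if_false, zero_add, sub_zero, norm_zero]
      exact add_nonneg hl0 hb0


/-! ## §2 The row bound -/

/-- **THE ROW BOUND** `λ_S = L·α = L/(5L−12)`, `β_S = (L−2)·α`, for the `d = 3` parameters of block size `L ≥ 5` (any `m`, `K`, `n`). -/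
theorem rowBound_P3 (hL5 : 5 ≤ L) :
    RowBound (P := P3 L m K hL) n 1 (kzS (P3 L m K hL)) ((L : ℝ) * alpha L) (((L : ℝ) - 2) * alpha L) := by
  intro μ ν hμν pp w Bw Bd hw hd
  have hBw : 0 ≤ Bw := (norm_nonneg _).trans (hw ⟨(μ, ν), hμν⟩ 0)
  have hd' : ∀ s : Fin 3 → ℤ, (∀ i, (s i).natAbs ≤ 1 + 1) → ‖d2 w 0 1 2 o01.2 o12.2 s‖ ≤ Bd :=
    fun s hs => hd 0 1 2 _ _ s hs
  have hBd : 0 ≤ Bd := (norm_nonneg _).trans (hd' 0 natAbs_zero_apply)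
  obtain ⟨rfl, rfl⟩ | ⟨rfl, rfl⟩ | ⟨rfl, rfl⟩ := orient_cases μ ν hμν
  · exact row01 hL5 pp w hw hd' hBw hBd hμν
  · exact row02 hL5 pp w hw hd' hBw hBd hμν
  · exact row12 hL5 pp w hw hd' hBw hBd hμν

end Rows

/-- The table does not depend on the run `K` (only on `d = 3` and `L`). -/
theorem kzS_P_eq (F : T3Family) (K : ℕ) : kzS (F.P K) = kzS (F.P 0) := rfl

/-- **THE FOUR HYPOTHESES OF `approxSmallLift_of_kernel` AT EVERY RUN** for a family of block size `L ≥ 5`, with the table `kzS (F.P 0)`,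
`K₁ = 36(L−2)α`, `λ = L·α`, `β = (L−2)·α`. -/
theorem kernel_hypotheses (F : T3Family) (hF : 5 ≤ F.L) (K : ℕ) :
    FaceSupported (P := F.P K) 1 (kzS (F.P 0)) ∧ SNeutral (P := F.P K) 1 (kzS (F.P 0)) ∧
      RowMass (P := F.P K) 1 (kzS (F.P 0)) (4 * (3 : ℝ) ^ 2 * (((F.L : ℝ) - 2) * alpha F.L)) ∧
      RowBound (P := F.P K) (Fin 2) 1 (kzS (F.P 0)) ((F.L : ℝ) * alpha F.L) (((F.L : ℝ) - 2) * alpha F.L) := by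
  rw [← kzS_P_eq F K]
  refine ⟨faceSupported, sNeutral (by exact le_trans (by norm_num) hF), ?_, ?_⟩
  · have h := rowMass (P := F.P K) (le_trans (by norm_num) hF)
    exact h
  · exact rowBound_P3 (L := F.L) (m := F.m) (K := K) (hL := F.hL) (n := Fin 2) hF

/-! ## §3 The per-`L` clause -/

/-- `λ_S(L)·√L < 1` for `5 ≤ L ≤ 19` (`⇔ L³ < (5L−12)²`; fails from `L = 20` on). -/
theorem gain_lt_one {L : ℕ} (h5 : 5 ≤ L) (h19 : L ≤ 19) : (L : ℝ) * alpha L * Real.sqrt L < 1 := by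
  have hL : (5 : ℝ) ≤ L := by exact_mod_cast h5
  have hcube : (L : ℝ) ^ 3 < (5 * (L : ℝ) - 12) ^ 2 := by
    interval_cases L <;> norm_num
  have hα := alpha_pos (by omega : 3 ≤ L)
  have hαm := alpha_mul (by omega : 3 ≤ L)
  have hden : 0 < 5 * (L : ℝ) - 12 := by linarith
  have hL0 : 0 < (L : ℝ) := by linarith
  have hsq : Real.sqrt L < (5 * (L : ℝ) - 12) / L := by
    rw [Real.sqrt_lt' (div_pos hden hL0), div_pow, lt_div_iff₀ (by positivity)]
    nlinarith
  calc (L : ℝ) * alpha L * Real.sqrt L < (L : ℝ) * alpha L * ((5 * (L : ℝ) - 12) / L) :=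
        mul_lt_mul_of_pos_left hsq (mul_pos hL0 hα)
    _ = alpha L * (5 * (L : ℝ) - 12) := by field_simp
    _ = 1 := hαm

/-- **THE PER-`L` CLAUSE OF THE REGISTERED STUB FOR ODD `5 ≤ L ≤ 19`**: the `L`-th hypothesis of
`ApproxLift.oneStepSmallLift_stub_of_approx` (p2 g8), by the face assembly `exists_approxSmallLift_of_kernel` (fleet F7) fed with ANSATZ S. -/
theorem perL_clause {L : ℕ} (hodd : Odd L) (h5 : 5 ≤ L) (h19 : L ≤ 19) :
    ∃ κ₀ C δ₀ : ℝ, 0 ≤ κ₀ ∧ κ₀ * Real.sqrt L < 1 ∧ 0 ≤ C ∧ 0 < δ₀ ∧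
      ∀ F : T3Family, F.L = L → ApproxSmallLift F κ₀ C δ₀ := by
  have hL' : Odd L ∧ 1 < L := ⟨hodd, by omega⟩
  have hL5 : (5 : ℝ) ≤ L := by exact_mod_cast h5
  have hα := (alpha_pos (by omega : 3 ≤ L)).le
  have hlam : 0 ≤ (L : ℝ) * alpha L := mul_nonneg (by positivity) hα
  have hβ : 0 ≤ ((L : ℝ) - 2) * alpha L := mul_nonneg (by linarith) hα
  have hK : 0 ≤ 4 * (3 : ℝ) ^ 2 * (((L : ℝ) - 2) * alpha L) := mul_nonneg (by positivity) hβ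
  refine exists_approxSmallLift_of_kernel L 1 (fun F => kzS (F.P 0)) hK hlam hβ (gain_lt_one h5 h19)
    (Cq_nonneg (P3 L 1 0 hL') 1 hlam hβ hK) fun F hFL => ⟨?_, fun K => ?_⟩
  · exact le_of_eq rfl
  · obtain ⟨L', hL'', m, hm⟩ := F
    subst hFL
    exact kernel_hypotheses ⟨L', hL'', m, hm⟩ h5 K

end Summit.QuantumFields.YangMills.Theorems.ApproxLift.AnsatzS

end
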